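import Summits.QuantumFields.BalabanUV.Beta.D1BFx.RestKernelGhostUnitRow

/-!
# `BalabanUV.Beta.D1BFx.RestKernelGhostWiring` — road «BF-x» for binder row D1, slot (K), DICT-CHAIN-SPEC §2 (II) row RK-GH («RK-GH-WIRE»):
# **THE TWELVE GHOST REST WORDS AS MEMBERS OF THE (K) POINTWISE SLOT** — a family `RkGh ω a i n μ ν` TOTAL in the block size `n`, carrying a DISPLAYED scalar
# loop-weight family `ω : ℕ → ℝ` (sign ∕ CHECK-N0 normalisation: leaf-04's reading is `ω := −1`), with the END's rows
# `hMR` (absolutely summable second moments at every `n = Lc ^ m`, `m ≥ 1`), `hRu`∕`hU` in BOTH readings (`Ru := secondMoment, CU′ := 0, CU := Ω·KU(a)` and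
# `Ru := 0, CU′ := Ω·KU(a), CU := 0`, under a displayed weight bound `|ω n| ≤ Ω`), the n-free constant `KU(a)` of leaf-04's FILE 4b NAMED (`KUgh a`), and the `n⁻²` surplus kept

HONEST DEPENDENCY (cell records, verbatim): «continuum YM on T⁴ ⇐ BetaPertH ∧ nine spine estimates (0/9 proved); BetaPertH ⇐ (D1) ∧ (D4) ∧
CAP+tail; G-an2-4 gates asym, D1 and NE2/3/4.»  HONEST FRAMING (cell contract, verbatim): «discharging `BetaPertH` makes Bałaban's UV stability
UNCONDITIONAL — a real constructive-QFT result; it is NOT the continuum limit and NOT the Clay problem.»  THIS MODULE DISCHARGES NOTHING of the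
wall: it is [folklore] re-indexing (`n = (n − 1) + 1`, `1 ≤ Lc ^ m`) of leaf-04 g18's UNCONDITIONAL «RK-GH-UNIT» letters (`RestKernelGhostUnit.decay510_word_*`,
`RestKernelGhostUnitRow.abs_secondMoment_ghostWordK_le(_unit)`) and of `DecimatedMomentSummable.absMoment₂_of_decay510`, over leaf-01 g20's words
`RestKernelGhostWords.ghostWordK`, plus three small [our object] DATA definitions (`RkGh` — the weighted member family, total in `n` by `dite`; `KUgh` — the displayed
n-free constant of FILE 4b, named; `RuGh` — reading (a)'s `Ru`).  UNCONDITIONAL (`0 < a` only): no `h12`∕`h126`, no printed statement, no `def … : Prop`,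
nothing cited, 0 sorry.  It supplies, BY NAME, the `υ`-FRAGMENT `GhIdx` of the binders `Rk`∕`hMR`∕`hRu`∕`hU` of `RoadEndBFxDictPointwiseS.hdict_of_pointwise` ∕
`d1Rep_BFx_of_D1Tel_ptw_sbpS` (p306436 ✓) and of the JOINT ROOT `RoadEndBFxJointCombShSym.d1Drift_JsB12CombShSym_BFx` (p314721 ✓) — it does NOT touch `hptw`
(the pointwise dictionary, chain (I)), `hU₁`, or any other member of `υ` (ΔGH — FILE 5 + `GhostPinnedTransfer`; the N-side block ∕ sandwich words; (S-LIT); (S-N)).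
0 root-level binders of row D1 discharged (hW ∕ hR-sockets ∕ hSX-socket ∕ D1Tel ∕ D1Rep — 0); (K) NOT closed; NOT D1, NOT `BetaPertH`, NOT continuum, NOT Clay.

ABSOLUTE RULE (cell charter, verbatim): «No internally-minted statement may enter as a cited fact. Every hypothesis is either kernel-proved in
this package or a verbatim quotation of a PUBLISHED theorem with page reference. The manuscript(s) under audit are NOT citable for their own
disputed steps — they are the thing under adjudication; programme-internal (2001/route/tribunal) claims are never citable.»

WHY (FILE 4's header, verbatim: «NOT HERE … the `Rk` wiring (leaf-01's rest-word lane)»; owner ruling ρ-g16-2 (2); g20's handoff (i), the located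
TYPING REMARK: `Ggh n a`, `Pgt n a`, `vertexRedF n` take `[NeZero n]` while the END's `Rk : υ → ℕ → Fin 4 → Fin 4 → Site 4 → ℝ` is TOTAL in `n`).
The END quantifies its (K) rows as `∀ (u : υ) (m : ℕ), 1 ≤ m → AbsMoment₂ (Rk u (Lc ^ m) μ ν)` (`hMR`),
`|secondMoment (Rk u (Lc ^ m)) μ ν − Ru u (Lc ^ m)| ≤ CU′ u` (`hRu`) and `∀ n, 2 ≤ n → ∀ u, |Ru u n| ≤ CU u` (`hU`); FILE 4∕4b state their letters at
`n := m + 1`.  HERE the two are joined: §1 the member family (`RkGh_of_neZero`: at any `[NeZero n]` it IS `ω n · ghostWordK (Ggh n a) (Pgt n a) 𝒱J 𝒲J i μ ν z` —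
`NeZero` is a `Prop`-class, so the `dite` instance and the ambient one agree by proof irrelevance; `RkGh_zero`: the junk value at `n = 0` is `0`);
§2 `hMR` (from FILE 4's twelve `Decay510` letters, rates `κ′∕8` ∕ `σ₀ > 0`, any weight); §3 the read-out rows with `KUgh a`, the `n⁻²` surplus and the weight
bound `Ω`; §4 the member sum pointwise (what the dictionary `hptw` will quote for the ghost `P`-remainder, with p309420's `pRem_sixteen_eq_sum_ghostWord`).
THE WEIGHT (leaf-04 g18 INBOX [D1LEAF04-G18-INBOX-1]: «per ghost member `u_i := −ghostWordK … i` (sign per (S-A1))»; OWNER ρ-g15-4: the unit∕colour factor between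
the dictionary's «2» and the END's `ωgh` is «a (K)-slot CHECK-N0 item»): the member carries `ω n` as a DISPLAYED scalar family, so that either reading is an
instantiation (`ω := fun _ => −1` is leaf-04's); the rows ask only `|ω n| ≤ Ω`.

CONTENT.
* §1 [our object] `RkGh ω a i n μ ν z`; [folklore] `RkGh_zero`, **`RkGh_of_neZero`**, `RkGh_succ`.
* §2 [folklore] `absMoment₂_ghostWordK_succ` (the unweighted word, from FILE 4's `Decay510` letters), `absMoment₂_RkGh_succ`, `absMoment₂_RkGh` (`1 ≤ n`),
  **`hMR_RkGh`** (the END's shape, any weight, any `[NeZero Lc]`).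
* §3 [our object] `KUgh a` (FILE 4b's displayed constant, verbatim); [folklore] `KUgh_nonneg`, **`abs_secondMoment_RkGh_le`** (`≤ |ω n|·KUgh a·(n²)⁻¹`, `1 ≤ n`),
  `abs_secondMoment_RkGh_le_unit` (`≤ Ω·KUgh a` under `|ω n| ≤ Ω`); reading (a): [our object] `RuGh`, [folklore] **`hRu_RuGh`** (`CU′ := 0`), **`hU_RuGh`**
  (`CU := Ω·KUgh a`); reading (b): **`hRu_zero_RkGh`** (`Ru := 0`, `CU′ := Ω·KUgh a`), `hU_zero` (`CU := 0`).
* §4 [folklore] `sum_RkGh_of_neZero` (the member sum IS `ω n · Σ_i ghostWordK … i μ ν z` at any `[NeZero n]`), `sum_RkGh_zero`.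
NOT HERE (honest): the ΔGH member (leaf-04's FILE 5 «ΔGH-UNIT» + `GhostPinnedTransfer.absMoment₂_deltaGH`; a sibling file), the dictionary `hptw`, `hU₁`,
every other member of `υ`; any statement about `TshotOf`.
Unit `b2b-balaban-beta-d1-formalise-leaf-01` (gen 21), D1 formalisation swarm leaf prover 01, road «BF-x»; INTENT «RK-GH-WIRE» (journal).
-/

noncomputable section

open Finset
open scoped BigOperators
open Literature.MathematicalPhysics.QuantumFieldTheory.Balaban1983to89
open Literature.MathematicalPhysics.QuantumFieldTheory.Balaban1983to89.Beta
open B12Sec2to5 (l1 Decay510)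
open B4Sect5Proof (latticeConst)
open B5Hk163Strip (kappa163 kappa163_pos)
open B5Hk163Decay (MG163)
open B4TorusKernel (periodConst)
open ExpKernelCalculus (Site MKer)
open DecimatedMomentSummable (AbsMoment₂ absMoment₂_of_decay510)
open Summit.QuantumFields.BalabanUV.Beta.D1BFx.RProjector (Pgt deltaPP)
open Summit.QuantumFields.BalabanUV.Beta.D1BFx.ProjectorSupNorm (cPPs)
open Summit.QuantumFields.BalabanUV.Beta.D1BFx.GhostLeg (Ggh)
open Summit.QuantumFields.BalabanUV.Beta.D1BFx.GhostLegFree (ghDelta)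
open Summit.QuantumFields.BalabanUV.Beta.D1BFx.GhostLegBlockMass (cNear)
open Summit.QuantumFields.BalabanUV.Beta.D1BFx.GhostStencil (ghCur)
open Summit.QuantumFields.BalabanUV.Beta.D1BFx.TorusGhostPairStencils (gh₂)
open Summit.QuantumFields.BalabanUV.Beta.D1BFx.ReducedKernelF (vertexRedF)
open Summit.QuantumFields.BalabanUV.Beta.D1BFx.ReducedTableF (tableRedF)
open Summit.QuantumFields.BalabanUV.Beta.D1BFx.RestKernelGhostWords (GhIdx ghostWordK)
open Summit.QuantumFields.BalabanUV.Beta.D1BFx.RestKernelGhostUnit (sigma_facts decay510_word_tadpole decay510_word_single_none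
  decay510_word_single_some decay510_word_double_self decay510_word_double_mixed)
open Summit.QuantumFields.BalabanUV.Beta.D1BFx.RestKernelGhostUnitRow (abs_secondMoment_ghostWordK_le abs_secondMoment_ghostWordK_le_unit)

namespace Summit.QuantumFields.BalabanUV.Beta.D1BFx.RestKernelGhostWiring

/-! ## §1 The twelve ghost members as a family TOTAL in the block size -/

/-- [our object] **THE GHOST FRAGMENT OF THE (K) SLOT**: `RkGh ω a i n μ ν z` := `ω n ·` leaf-01's ghost rest word `ghostWordK (Ggh n a) (Pgt n a) 𝒱J 𝒲J i μ ν z` at the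
`ℋ`-packed ghost jets of record (`𝒱J := (n²)•vertexRedF n ghCur`, `𝒲J := (n²)•tableRedF n ([u = u′][κ = l]•gh₂)`, the η-expanded families of FILE 4) for
`n ≠ 0` (`ω : ℕ → ℝ` a DISPLAYED scalar loop-weight family — sign and CHECK-N0 normalisation are the consumer's), and `0` at the junk block size `n = 0` — a `dite`, so that the
family is TOTAL in `n` as the END's `Rk : υ → ℕ → …` requires.  A DEFINITION; asserts nothing. -/
def RkGh (ω : ℕ → ℝ) (a : ℝ) (i : GhIdx) (n : ℕ) (μ ν : Fin 4) (z : Site 4) : ℝ :=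
  if h : n = 0 then 0 else
    haveI : NeZero n := ⟨h⟩
    ω n * ghostWordK (Ggh n a) (Pgt n a) (fun κ u => (((n : ℕ) : ℝ) ^ 2) • vertexRedF n (fun κ u => ghCur κ u) κ u)
      (fun κ u l u' => (((n : ℕ) : ℝ) ^ 2) • tableRedF n (fun κ u l u' => if u = u' ∧ κ = l then gh₂ κ u else 0) κ u l u') i μ ν z

/-- [our object] The junk value: at `n = 0` every member is the zero kernel. -/
theorem RkGh_zero (ω : ℕ → ℝ) (a : ℝ) (i : GhIdx) : RkGh ω a i 0 = fun _ _ _ => 0 := by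
  funext μ ν z
  simp [RkGh]

/-- [folklore] **AT ANY `[NeZero n]` THE MEMBER IS THE GHOST WORD OF RECORD** (the `dite` branch; the `NeZero n` instance manufactured inside the definition
and the ambient one are proofs of one `Prop`, hence the two sides agree definitionally). -/
theorem RkGh_of_neZero (ω : ℕ → ℝ) (a : ℝ) (i : GhIdx) (n : ℕ) [NeZero n] :
    RkGh ω a i n = fun μ ν z => ω n * ghostWordK (Ggh n a) (Pgt n a) (fun κ u => (((n : ℕ) : ℝ) ^ 2) • vertexRedF n (fun κ u => ghCur κ u) κ u)
      (fun κ u l u' => (((n : ℕ) : ℝ) ^ 2) • tableRedF n (fun κ u l u' => if u = u' ∧ κ = l then gh₂ κ u else 0) κ u l u') i μ ν z := by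
  funext μ ν z
  rw [RkGh, dif_neg (NeZero.ne n)]

/-- [folklore] … in FILE 4's indexing `n := m + 1`. -/
theorem RkGh_succ (ω : ℕ → ℝ) (a : ℝ) (i : GhIdx) (m : ℕ) :
    RkGh ω a i (m + 1) = fun μ ν z => ω (m + 1) * ghostWordK (Ggh (m + 1) a) (Pgt (m + 1) a)
      (fun κ u => (((m + 1 : ℕ) : ℝ) ^ 2) • vertexRedF (m + 1) (fun κ u => ghCur κ u) κ u)
      (fun κ u l u' => (((m + 1 : ℕ) : ℝ) ^ 2) • tableRedF (m + 1) (fun κ u l u' => if u = u' ∧ κ = l then gh₂ κ u else 0) κ u l u') i μ ν z :=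
  RkGh_of_neZero ω a i (m + 1)

/-! ## §2 The `hMR` row: absolutely summable second moments at every block size `n ≥ 1` -/

section Rows

variable (ω : ℕ → ℝ) {a : ℝ} (ha : 0 < a)
include ha

/-- [folklore] The UNWEIGHTED word has an absolutely summable second moment at `n = m + 1` (FILE 4's twelve `Decay510` letters, rates `κ′∕8` ∕ `σ₀ > 0`,
through `absMoment₂_of_decay510`). -/
theorem absMoment₂_ghostWordK_succ (i : GhIdx) (m : ℕ) (μ ν : Fin 4) :
    AbsMoment₂ (ghostWordK (Ggh (m + 1) a) (Pgt (m + 1) a)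
      (fun κ u => (((m + 1 : ℕ) : ℝ) ^ 2) • vertexRedF (m + 1) (fun κ u => ghCur κ u) κ u)
      (fun κ u l u' => (((m + 1 : ℕ) : ℝ) ^ 2) • tableRedF (m + 1) (fun κ u l u' => if u = u' ∧ κ = l then gh₂ κ u else 0) κ u l u') i μ ν) := by
  obtain ⟨-, -, -, -, -, hσ0⟩ := sigma_facts m ha
  have hκ8 : 0 < kappa163 (3 + 1) / (3 + 1) / 8 := by have := kappa163_pos (3 + 1); positivity
  rcases i with b | ⟨π, t⟩ | b | b
  · exact absMoment₂_of_decay510 hκ8 (decay510_word_tadpole m ha b μ ν)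
  · rcases π with _ | t'
    · exact absMoment₂_of_decay510 hσ0 (decay510_word_single_none m ha t μ ν)
    · exact absMoment₂_of_decay510 hσ0 (decay510_word_single_some m ha t' t μ ν)
  · exact absMoment₂_of_decay510 hσ0 (decay510_word_double_self m ha b μ ν)
  · exact absMoment₂_of_decay510 hσ0 (decay510_word_double_mixed m ha b μ ν)

/-- [folklore] Every member has an absolutely summable second moment at `n = m + 1` (any weight: `AbsMoment₂` is stable under scalars). -/
theorem absMoment₂_RkGh_succ (i : GhIdx) (m : ℕ) (μ ν : Fin 4) : AbsMoment₂ (RkGh ω a i (m + 1) μ ν) := by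
  rw [RkGh_succ]
  have h := absMoment₂_ghostWordK_succ ha i m μ ν
  unfold AbsMoment₂ at h ⊢
  refine (h.mul_left |ω (m + 1)|).congr fun z => ?_
  rw [abs_mul]
  ring

/-- [folklore] … at every `n ≥ 1` (`n = (n − 1) + 1`). -/
theorem absMoment₂_RkGh (i : GhIdx) {n : ℕ} (hn : 1 ≤ n) (μ ν : Fin 4) : AbsMoment₂ (RkGh ω a i n μ ν) := by
  obtain ⟨m, rfl⟩ : ∃ m, n = m + 1 := ⟨n - 1, (Nat.sub_add_cancel hn).symm⟩
  exact absMoment₂_RkGh_succ ω ha i m μ ν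

/-- [folklore] **THE END's `hMR` ROW FOR THE GHOST FRAGMENT**, in the shape `RoadEndBFxDictPointwiseS.hdict_of_pointwise` displays it
(`∀ (u : υ) (m : ℕ), 1 ≤ m → AbsMoment₂ (Rk u (Lc ^ m) μ ν)` at `υ := GhIdx`, `Rk := RkGh ω a`; any weight `ω`, any `[NeZero Lc]`, since `1 ≤ Lc ^ m`). -/
theorem hMR_RkGh {Lc : ℕ} [NeZero Lc] (μ ν : Fin 4) : ∀ (i : GhIdx) (m : ℕ), 1 ≤ m → AbsMoment₂ (RkGh ω a i (Lc ^ m) μ ν) :=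
  fun i m _ => absMoment₂_RkGh ω ha i (Nat.one_le_pow m Lc (Nat.pos_of_ne_zero (NeZero.ne Lc))) μ ν

end Rows

/-! ## §3 The read-out rows: the n-free constant `KU(a)` named, the `n⁻²` surplus, both readings of `Ru` -/

/-- [our object] **`KU(a)`** — leaf-04 g18's displayed n-free constant of `RestKernelGhostUnitRow.abs_secondMoment_ghostWordK_le(_unit)`, VERBATIM, given a name
(`SP·MG·CW·M(κ′∕8)` for the tadpoles + the generous product sum × `CV²·M(σ₀)` for the bubbles, halved).  A DEFINITION of a real number; asserts nothing. -/
def KUgh (a : ℝ) : ℝ :=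
  (1 / 2) * ((cPPs 4 a * (cNear a * latticeConst 4 (ghDelta a))
      * (32 * ((MG163 (3 + 1) * periodConst (kappa163 (3 + 1)) 3) * Real.exp (kappa163 (3 + 1) / (3 + 1))) ^ 2 * (1 + 16 / (kappa163 (3 + 1) / (3 + 1))) ^ 4)
      * ∑' x : Site 4, l1 x ^ 2 * Real.exp (-(kappa163 (3 + 1) / (3 + 1) / 8) * l1 x))
    + (((2 / min 2 a * (cNear a * latticeConst 4 (ghDelta a)) + 2 / min 2 a
          + cPPs 4 a * Real.exp (deltaPP 4 a) * (2 / min 2 a) * (1 + 16 / deltaPP 4 a) ^ 4)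
        * (cPPs 4 a * Real.exp (deltaPP 4 a) + cPPs 4 a * (cNear a * latticeConst 4 (ghDelta a)) + (cNear a * latticeConst 4 (ghDelta a)) * cPPs 4 a)
        + cPPs 4 a * Real.exp (deltaPP 4 a) * ((cNear a * latticeConst 4 (ghDelta a)) * (cPPs 4 a * (cNear a * latticeConst 4 (ghDelta a)))))
      * (8 * Real.exp (kappa163 (3 + 1) / (3 + 1) / 16) * (MG163 (3 + 1) * periodConst (kappa163 (3 + 1)) 3) * Real.exp (kappa163 (3 + 1) / (3 + 1))
          * (1 + 16 / (kappa163 (3 + 1) / (3 + 1))) ^ 4) ^ 2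
      * ∑' x : Site 4, l1 x ^ 2 * Real.exp (-(min (deltaPP 4 a / 8) (kappa163 (3 + 1) / (3 + 1) / 16)) * l1 x)))

section ReadOut

variable (ω : ℕ → ℝ) {a : ℝ} (ha : 0 < a)
include ha

/-- [folklore] `0 ≤ KU(a)` (it dominates an absolute value: FILE 4b's unit row at `m = 0`). -/
theorem KUgh_nonneg : 0 ≤ KUgh a :=
  (abs_nonneg _).trans (abs_secondMoment_ghostWordK_le_unit 0 ha (Sum.inl true) 0 0)

/-- [folklore] **THE `n⁻²` SURPLUS, KEPT**: `|secondMoment (RkGh ω a i n) μ ν| ≤ |ω n|·KU(a)·(n²)⁻¹` for every `n ≥ 1` (FILE 4b's `abs_secondMoment_ghostWordK_le`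
re-indexed; the (1.22) moment is homogeneous in the kernel). -/
theorem abs_secondMoment_RkGh_le (i : GhIdx) {n : ℕ} (hn : 1 ≤ n) (μ ν : Fin 4) :
    |B12Beta.secondMoment (RkGh ω a i n) μ ν| ≤ |ω n| * (KUgh a * (((n : ℝ)) ^ 2)⁻¹) := by
  obtain ⟨m, rfl⟩ : ∃ m, n = m + 1 := ⟨n - 1, (Nat.sub_add_cancel hn).symm⟩
  rw [RkGh_succ]
  have hhom : ∀ (c : ℝ) (P : B12Beta.Kernel 4), B12Beta.secondMoment (fun μ' ν' z => c * P μ' ν' z) μ ν = c * B12Beta.secondMoment P μ ν :=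
    fun c P => by
      simp only [B12Beta.secondMoment, ← tsum_mul_left]
      exact tsum_congr fun z => by ring
  rw [hhom, abs_mul]
  exact mul_le_mul_of_nonneg_left (abs_secondMoment_ghostWordK_le m ha i μ ν) (abs_nonneg _)

/-- [folklore] **THE n-UNIFORM UNIT ROW** under a displayed weight bound `|ω n| ≤ Ω`: `|secondMoment (RkGh ω a i n) μ ν| ≤ Ω·KU(a)` for every `n ≥ 1`. -/
theorem abs_secondMoment_RkGh_le_unit {Ω : ℝ} (hω : ∀ n, |ω n| ≤ Ω) (i : GhIdx) {n : ℕ} (hn : 1 ≤ n) (μ ν : Fin 4) :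
    |B12Beta.secondMoment (RkGh ω a i n) μ ν| ≤ Ω * KUgh a := by
  have hK := KUgh_nonneg ha
  have hn1 : (1 : ℝ) ≤ (n : ℝ) := by exact_mod_cast hn
  have hN2 : (((n : ℝ)) ^ 2)⁻¹ ≤ 1 := inv_le_one_of_one_le₀ (one_le_pow₀ hn1)
  calc |B12Beta.secondMoment (RkGh ω a i n) μ ν| ≤ |ω n| * (KUgh a * (((n : ℝ)) ^ 2)⁻¹) := abs_secondMoment_RkGh_le ω ha i hn μ ν
    _ ≤ Ω * (KUgh a * 1) :=
        mul_le_mul (hω n) (mul_le_mul_of_nonneg_left hN2 hK) (by positivity) ((abs_nonneg _).trans (hω n))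
    _ = Ω * KUgh a := by rw [mul_one]

end ReadOut

/-- [our object] READING (a) (FILE 4's header: «`Ru := secondMoment`, `CU′ := 0`, `CU` below»): the ghost fragment of the END's `Ru : υ → ℕ → ℝ` at the fixed
channel `μ ν` is the second moment of the weighted member itself.  A DEFINITION; asserts nothing. -/
def RuGh (ω : ℕ → ℝ) (a : ℝ) (μ ν : Fin 4) : GhIdx → ℕ → ℝ := fun i n => B12Beta.secondMoment (RkGh ω a i n) μ ν

section Readings

variable (ω : ℕ → ℝ) {a : ℝ}

/-- [folklore] READING (a), **THE END's `hRu` ROW** with `CU′ := 0`: `|secondMoment (RkGh ω a i (Lc ^ m)) μ ν − RuGh ω a μ ν i (Lc ^ m)| ≤ 0`. -/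
theorem hRu_RuGh {Lc : ℕ} (μ ν : Fin 4) :
    ∀ (i : GhIdx) (m : ℕ), 1 ≤ m → |B12Beta.secondMoment (RkGh ω a i (Lc ^ m)) μ ν - RuGh ω a μ ν i (Lc ^ m)| ≤ (fun _ : GhIdx => (0 : ℝ)) i := by
  intro i m _
  simp [RuGh]

/-- [folklore] READING (a), **THE END's `hU` ROW** with `CU := Ω·KU(a)`: `∀ n, 2 ≤ n → ∀ i, |RuGh ω a μ ν i n| ≤ Ω·KU(a)` (`0 < a`, `|ω n| ≤ Ω`). -/
theorem hU_RuGh (ha : 0 < a) {Ω : ℝ} (hω : ∀ n, |ω n| ≤ Ω) (μ ν : Fin 4) :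
    ∀ n : ℕ, 2 ≤ n → ∀ i : GhIdx, |RuGh ω a μ ν i n| ≤ (fun _ : GhIdx => Ω * KUgh a) i :=
  fun _ hn i => abs_secondMoment_RkGh_le_unit ω ha hω i (le_trans one_le_two hn) μ ν

/-- [folklore] READING (b), **THE END's `hRu` ROW** with `Ru := 0`, `CU′ := Ω·KU(a)` (`0 < a`, `|ω n| ≤ Ω`; any `[NeZero Lc]`):
`|secondMoment (RkGh ω a i (Lc ^ m)) μ ν − 0| ≤ Ω·KU(a)`. -/
theorem hRu_zero_RkGh {Lc : ℕ} [NeZero Lc] (ha : 0 < a) {Ω : ℝ} (hω : ∀ n, |ω n| ≤ Ω) (μ ν : Fin 4) :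
    ∀ (i : GhIdx) (m : ℕ), 1 ≤ m →
      |B12Beta.secondMoment (RkGh ω a i (Lc ^ m)) μ ν - (fun (_ : GhIdx) (_ : ℕ) => (0 : ℝ)) i (Lc ^ m)| ≤ (fun _ : GhIdx => Ω * KUgh a) i := by
  intro i m _
  simp only [sub_zero]
  exact abs_secondMoment_RkGh_le_unit ω ha hω i (Nat.one_le_pow m Lc (Nat.pos_of_ne_zero (NeZero.ne Lc))) μ ν

/-- [folklore] READING (b), the `hU` row is vacuous: `|0| ≤ 0`. -/
theorem hU_zero : ∀ n : ℕ, 2 ≤ n → ∀ i : GhIdx, |(fun (_ : GhIdx) (_ : ℕ) => (0 : ℝ)) i n| ≤ (fun _ : GhIdx => (0 : ℝ)) i :=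
  fun _ _ _ => by simp

end Readings

/-! ## §4 The member sum, pointwise (what the dictionary will quote) -/

/-- [folklore] **THE GHOST FRAGMENT's CONTRIBUTION TO `Σ_u Rk u n μ ν z`** at any `[NeZero n]` is the sum of the twelve words of record
(to be matched against p309420's `pRem_sixteen_eq_sum_ghostWord` by the dictionary `hptw`; nothing about `TshotOf` is claimed here). -/
theorem sum_RkGh_of_neZero (ω : ℕ → ℝ) (a : ℝ) (n : ℕ) [NeZero n] (μ ν : Fin 4) (z : Site 4) :
    ∑ i : GhIdx, RkGh ω a i n μ ν z
      = ω n * ∑ i : GhIdx, ghostWordK (Ggh n a) (Pgt n a) (fun κ u => (((n : ℕ) : ℝ) ^ 2) • vertexRedF n (fun κ u => ghCur κ u) κ u)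
          (fun κ u l u' => (((n : ℕ) : ℝ) ^ 2) • tableRedF n (fun κ u l u' => if u = u' ∧ κ = l then gh₂ κ u else 0) κ u l u') i μ ν z := by
  rw [Finset.mul_sum]
  exact Finset.sum_congr rfl fun i _ => by rw [RkGh_of_neZero]

/-- [folklore] … and at the junk block size it is `0`. -/
theorem sum_RkGh_zero (ω : ℕ → ℝ) (a : ℝ) (μ ν : Fin 4) (z : Site 4) : ∑ i : GhIdx, RkGh ω a i 0 μ ν z = 0 :=
  Finset.sum_eq_zero fun i _ => by rw [RkGh_zero]

end Summit.QuantumFields.BalabanUV.Beta.D1BFx.RestKernelGhostWiring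

end
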